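import Summits.QuantumAdvantage.QuantumAdvantage.Theorems.CubicForrelationNearExactIsExactTwelveLevelSixDeltaZeroDead
import Summits.QuantumAdvantage.QuantumAdvantage.Theorems.CubicForrelationNearExactIsExactTwelveLevelSixH34Small
import Summits.QuantumAdvantage.QuantumAdvantage.Theorems.CubicForrelationNearExactIsExactKtGapAll
import Summits.QuantumAdvantage.QuantumAdvantage.Theorems.CubicForrelationNearExactIsExactValueGranularity
import Summits.QuantumAdvantage.QuantumAdvantage.Theorems.CubicForrelationNearExactIsExactSecondWeight

/-!
# Crux `CubicForrelation.NearExactIsExact` (stmt-QuantumAdvantage-14043) — n = 12 AT `Φ = 29/32`, level-6 configuration (γ): EVERY sub-case with a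
  off-flat part meeting at most `31` points with `8 ∤ e` (hence `Σ_{off Z}|e| < 128`) is DEAD against a level-6 partner (no hypothesis on `Φ`)

Certificate seat `b2b-cforr-cert` (gen 23).  HONEST FRAMING: finite-slice lemmas (standard axioms) about cubic Boolean pairs on 12 bits — a generic
brick for the residual configuration (γ) (`#Z = 512`, `e = ±1` on the 9-flat `Z`, off-flat energy `256`) of HOME/b2b-cforr-cert-g23/PLAN-N12-928-L6.md:
it kills at once every atom pattern of the off-flat part with at most ONE 16-point `±2`-flat (one `±2`-flat plus a `±4`-flat or `±8`-points, two
`±4`-flats, a `±4`-flat plus `±8`-points, four `±8`-points, a single `±16`, …); left are the patterns with `≥ 2` `±2`-flats.  It does NOT decide (γ);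
NOT summit progress.

THE ARGUMENT (`tw23_levelSix_gamma_small_false`).  (H3)/(H4) on `Z` by avoidance (`sm_H34_small`); as `e = σ` on `Z`, they hold for `σ = sZ∘hb`,
so `fr_hsd` / `fr_radical_large` give `4·#R ≥ 512` for the radical `R` of the relative form; `R` is a subgroup of `V₀`, so `#R = 2^k`
(`sw_card_xorClosed`), `k ∈ {7,8,9}`.  The integer character sum `M(y) = Σ_{x∈Z} σ(x)(−1)^{x·y}` has `M² = 512·S_R` with `S_R ∈ {0, #R}`
(`d0_Shat_sq`, `bd_hom_sum`), so `M² ∈ {0, 2^{9+k}}`; a square power of two has even exponent (`ktg_sq_eq_two_pow`), hence `256 ∣ M(y)` for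
all `y`.  Duality `ê = −64e_f` then puts the transform `ν̂ = ê − M` of the off-flat part `ν` in `64ℤ`, while `|ν̂| ≤ Σ|ν| < 128`: `ν̂ = 64j`
with `j ∈ {0, ±1}`, and Parseval `Σ ν̂² = 4096·256` gives exactly `256` points with `j ≠ 0`.  But `e_f = −4m − j`, so `{w_f even} = {j ≠ 0}`
would be the support of a cubic (`stub_walshTower`) with `256 < 512` points — impossible (`bb_rmWeight_holds`).

References: MacWilliams–Sloane (1977) Ch. 13–15; R. O'Donnell (2014) §1.4.  Axioms: the standard three.
-/

set_option linter.dupNamespace false -- D-0017: single-problem summit ⇒ `QuantumAdvantage.QuantumAdvantage` by design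

noncomputable section

namespace Summit.QuantumAdvantage.QuantumAdvantage.Theorems.CubicForrelation.NearExactIsExact

open Finset
open Literature.Computability.QuantumComplexity
open Literature.Computability.QuantumComplexity.BuzetChailloux (bxor zeroVec bxor_bxor_cancel_left bxor_zeroVec zeroVec_bxor bxor_comm
  bxor_self)
open Literature.Computability.QuantumComplexity.DerivativeWalsh (W)
open Literature.Computability.QuantumComplexity.DerivativeWalsh (twist_bxor_left sum_W_sq)
open Literature.Computability.QuantumComplexity.Simon (twist_eq_one_or)

/-! ### `S_R ∈ {0, #R}` -/

/-- **`S_R(y) ∈ {0, #R}`** for the radical `R` of a relative form with base-free second differences on the coset (`bd_hom_sum`). [this work] -/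
theorem gs_SR (V₀ : Finset (Fin (6 + 6) → Bool)) (u'' : (Fin (6 + 6) → Bool) → ℤ) (xZ : Fin (6 + 6) → Bool) (h0 : zeroVec ∈ V₀)
    (hadd : ∀ a ∈ V₀, ∀ b ∈ V₀, bxor a b ∈ V₀) (hS : (univ.filter fun x : Fin (6 + 6) → Bool => ¬ Odd (u'' x)) = V₀.image (bxor xZ))
    (hb : (Fin (6 + 6) → Bool) → Bool)
    (hsd : ∀ x, x ∈ (univ.filter fun x : Fin (6 + 6) → Bool => ¬ Odd (u'' x)) → ∀ p ∈ V₀, ∀ q ∈ V₀, hb (bxor (bxor x p) q) =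
      (hb x ^^ hb (bxor x p) ^^ hb (bxor x q) ^^ (hb xZ ^^ hb (bxor xZ p) ^^ hb (bxor xZ q) ^^ hb (bxor (bxor xZ p) q))))
    (y : Fin (6 + 6) → Bool) :
    ∑ t ∈ (V₀.filter fun r => ∀ v ∈ V₀, (hb xZ ^^ hb (bxor xZ r) ^^ hb (bxor xZ v) ^^ hb (bxor (bxor xZ r) v)) = false), signOf (hb xZ ^^ hb (bxor xZ t)) * twist t y = 0 ∨
      ∑ t ∈ (V₀.filter fun r => ∀ v ∈ V₀, (hb xZ ^^ hb (bxor xZ r) ^^ hb (bxor xZ v) ^^ hb (bxor (bxor xZ r) v)) = false), signOf (hb xZ ^^ hb (bxor xZ t)) * twist t y = #(V₀.filter fun r => ∀ v ∈ V₀, (hb xZ ^^ hb (bxor xZ r) ^^ hb (bxor xZ v) ^^ hb (bxor (bxor xZ r) v)) = false) := by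
  classical
  have hxZ : xZ ∈ (univ.filter fun x : Fin (6 + 6) → Bool => ¬ Odd (u'' x)) := by rw [hS]; exact mem_image.2 ⟨zeroVec, h0, bxor_zeroVec xZ⟩
  have hPV : ∀ x, x ∈ (univ.filter fun x : Fin (6 + 6) → Bool => ¬ Odd (u'' x)) → ∀ a ∈ V₀, bxor x a ∈ (univ.filter fun x : Fin (6 + 6) → Bool => ¬ Odd (u'' x)) := fun x hx a ha => fl1_coset_vadd hadd hS hx ha
  have hRadd := fr_radical_add V₀ (· ∈ (univ.filter fun x : Fin (6 + 6) → Bool => ¬ Odd (u'' x))) xZ hb hxZ hPV hadd hsd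
  have h1 : ∀ t ∈ (V₀.filter fun r => ∀ v ∈ V₀, (hb xZ ^^ hb (bxor xZ r) ^^ hb (bxor xZ v) ^^ hb (bxor (bxor xZ r) v)) = false), signOf (hb xZ ^^ hb (bxor xZ t)) * twist t y = 1 ∨ signOf (hb xZ ^^ hb (bxor xZ t)) * twist t y = -1 := by
    intro t _
    rcases twist_eq_one_or t y with h | h <;> cases (hb xZ ^^ hb (bxor xZ t)) <;> simp [signOf, h]
  have hmul : ∀ t ∈ (V₀.filter fun r => ∀ v ∈ V₀, (hb xZ ^^ hb (bxor xZ r) ^^ hb (bxor xZ v) ^^ hb (bxor (bxor xZ r) v)) = false), ∀ s ∈ (V₀.filter fun r => ∀ v ∈ V₀, (hb xZ ^^ hb (bxor xZ r) ^^ hb (bxor xZ v) ^^ hb (bxor (bxor xZ r) v)) = false),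
      signOf (hb xZ ^^ hb (bxor xZ (bxor t s))) * twist (bxor t s) y = (signOf (hb xZ ^^ hb (bxor xZ t)) * twist t y) * (signOf (hb xZ ^^ hb (bxor xZ s)) * twist s y) := by
    intro t ht s hs
    have htV : t ∈ V₀ := (mem_filter.1 ht).1
    have hsV : s ∈ V₀ := (mem_filter.1 hs).1
    have hts : (hb xZ ^^ hb (bxor xZ t) ^^ hb (bxor xZ s) ^^ hb (bxor (bxor xZ t) s)) = false := (mem_filter.1 ht).2 s hsV
    rw [twist_bxor_left, ← iw_bxor_assoc xZ t s, hsd xZ hxZ t htV s hsV, hts]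
    cases hb xZ <;> cases hb (bxor xZ t) <;> cases hb (bxor xZ s) <;> simp [signOf]
  exact bd_hom_sum (V₀.filter fun r => ∀ v ∈ V₀, (hb xZ ^^ hb (bxor xZ r) ^^ hb (bxor xZ v) ^^ hb (bxor (bxor xZ r) v)) = false) hRadd (fun t => signOf (hb xZ ^^ hb (bxor xZ t)) * twist t y) h1 hmul

/-! ### The generic kill for small off-flat parts -/

/-- **(γ) with a small off-flat part is DEAD** (12 bits): cubic `f, g`, `W_g = 64u''`, `W_f = 64w_f`, `Z = {u'' even}` a
9-flat with `e² = 1` on `Z` (`e = u'' − (−1)^f`), at most `31` points off `Z` with `8 ∤ e`, `Σ_{x ∉ Z} |e(x)| < 128` and off-flat energy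
`Σ_{x ∉ Z} e² = 256` — impossible.  NOT summit progress. [this work] -/
theorem tw23_levelSix_gamma_small_false (f g : (Fin (6 + 6) → Bool) → Bool) (hf : IsDegLeFun 3 f) (hg : IsDegLeFun 3 g)
    (u'' : (Fin (6 + 6) → Bool) → ℤ) (hu'' : ∀ x, W (fun y => signOf (g y)) x = (2 : ℝ) ^ 6 * (u'' x : ℝ))
    (V₀ : Finset (Fin (6 + 6) → Bool)) (xZ : Fin (6 + 6) → Bool) (h0 : zeroVec ∈ V₀) (hadd : ∀ a ∈ V₀, ∀ b ∈ V₀, bxor a b ∈ V₀)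
    (hcardV : #V₀ = 512) (hS : (univ.filter fun x : Fin (6 + 6) → Bool => ¬ Odd (u'' x)) = V₀.image (bxor xZ))
    (hZ1 : ∀ x ∈ (univ.filter fun x : Fin (6 + 6) → Bool => ¬ Odd (u'' x)), (u'' x - sZ (f x)) ^ 2 = 1)
    (Bd : Finset (Fin (6 + 6) → Bool)) (hBd : ∀ y, y ∉ (univ.filter fun x : Fin (6 + 6) → Bool => ¬ Odd (u'' x)) → y ∉ Bd → (8 : ℤ) ∣ (u'' y - sZ (f y))) (hc : #Bd ≤ 31)
    (hl1 : ∑ y ∈ univ.filter (fun y => y ∉ (univ.filter fun x : Fin (6 + 6) → Bool => ¬ Odd (u'' x))), |(u'' y - sZ (f y))| < 128)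
    (hoff : ∑ y ∈ univ.filter (fun y => y ∉ (univ.filter fun x : Fin (6 + 6) → Bool => ¬ Odd (u'' x))), (u'' y - sZ (f y)) ^ 2 = 256)
    (wf : (Fin (6 + 6) → Bool) → ℤ) (hwf : ∀ y, W (fun x => signOf (f x)) y = (2 : ℝ) ^ 6 * (wf y : ℝ)) : False := by
  classical
  set Z := (univ.filter fun x : Fin (6 + 6) → Bool => ¬ Odd (u'' x)) with hZdef
  have hmemZ : ∀ x, x ∈ Z ↔ ¬ Odd (u'' x) := fun x => by simp [hZdef]
  set e : (Fin (6 + 6) → Bool) → ℤ := fun x => u'' x - sZ (f x) with hedef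
  have hxZ : xZ ∈ Z := by rw [hS]; exact mem_image.2 ⟨zeroVec, h0, bxor_zeroVec xZ⟩
  have hPV : ∀ x, x ∈ Z → ∀ a ∈ V₀, bxor x a ∈ Z := fun x hx a ha => fl1_coset_vadd hadd hS hx ha
  have hVP : ∀ x, x ∈ Z → bxor xZ x ∈ V₀ := fun x hx => fl1_coset_diff hS hx
  -- the sign `hb` with `sZ ∘ hb = e` on `Z`
  set hb : (Fin (6 + 6) → Bool) → Bool := fun x => decide (e x = -1) with hhb
  have hpm : ∀ x ∈ Z, e x = 1 ∨ e x = -1 := by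
    intro x hx
    have h1 : e x ^ 2 = 1 := hZ1 x hx
    have h2 : (e x - 1) * (e x + 1) = 0 := by nlinarith
    rcases mul_eq_zero.1 h2 with h | h
    · left; linarith
    · right; linarith
  have hsZ : ∀ x ∈ Z, sZ (hb x) = e x := by
    intro x hx; rcases hpm x hx with h | h <;> simp only [hb, h] <;> decide
  -- (H3)/(H4) on `Z`
  obtain ⟨H3, H4⟩ := sm_H34_small f g hf hg u'' hu'' V₀ xZ h0 hadd hcardV hS Bd hBd hc
  have H3σ : ∀ x, x ∈ Z → ∀ a b c : Fin (6 + 6) → Bool, a ∈ V₀ → b ∈ V₀ → c ∈ V₀ →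
      (4 : ℤ) ∣ ∑ ε : Fin 3 → Bool, sZ (hb (fun j => x j ^^ decide (Odd #(univ.filter fun i => ε i && (![a, b, c] : Fin 3 → Fin (6 + 6) → Bool) i j)))) := by
    intro x hx a b c ha hb' hc'
    have hmem : ∀ ε : Fin 3 → Bool, (fun j => x j ^^ decide (Odd #(univ.filter fun i => ε i && (![a, b, c] : Fin 3 → Fin (6 + 6) → Bool) i j))) ∈ Z :=
      fun ε => fr_mem_flatPt3 V₀ h0 (· ∈ Z) hPV hx _ (fun i => by fin_cases i <;> assumption) ε
    rw [sum_congr rfl fun ε _ => hsZ _ (hmem ε)]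
    exact H3 x hx a b c ha hb' hc'
  have H4σ : ∀ x, x ∈ Z → ∀ a₀ a₁ a₂ a₃ : Fin (6 + 6) → Bool, a₀ ∈ V₀ → a₁ ∈ V₀ → a₂ ∈ V₀ → a₃ ∈ V₀ →
      (8 : ℤ) ∣ ∑ ε : Fin 4 → Bool, sZ (hb (fun j => x j ^^ decide (Odd #(univ.filter fun i => ε i && (![a₀, a₁, a₂, a₃] : Fin 4 → Fin (6 + 6) → Bool) i j)))) := by
    intro x hx a₀ a₁ a₂ a₃ ha₀ ha₁ ha₂ ha₃
    have hmem : ∀ ε : Fin 4 → Bool, (fun j => x j ^^ decide (Odd #(univ.filter fun i => ε i && (![a₀, a₁, a₂, a₃] : Fin 4 → Fin (6 + 6) → Bool) i j))) ∈ Z :=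
      fun ε => fr_mem_flatPt4 V₀ h0 (· ∈ Z) hPV hx _ (fun i => by fin_cases i <;> assumption) ε
    rw [sum_congr rfl fun ε _ => hsZ _ (hmem ε)]
    exact H4 x hx a₀ a₁ a₂ a₃ ha₀ ha₁ ha₂ ha₃
  have hsd := fr_hsd V₀ (· ∈ Z) xZ hxZ hVP hb H3σ
  have hRbig := fr_radical_large V₀ (· ∈ Z) xZ hb hadd hxZ hPV hVP H3σ H4σ
  set R := (V₀.filter fun r => ∀ v ∈ V₀, (hb xZ ^^ hb (bxor xZ r) ^^ hb (bxor xZ v) ^^ hb (bxor (bxor xZ r) v)) = false) with hR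
  rw [hcardV] at hRbig
  -- `#R = 2^k`, `k ≥ 7`
  have hRadd := fr_radical_add V₀ (· ∈ Z) xZ hb hxZ hPV hadd hsd
  have hR0 : zeroVec ∈ R := fr_radical_zero_mem V₀ xZ hb h0
  obtain ⟨k, -, hk⟩ := sw_card_xorClosed R hR0 hRadd
  have hk7 : 7 ≤ k := by
    by_contra hlt
    push Not at hlt
    rw [hk] at hRbig
    interval_cases k <;> norm_num at hRbig
  -- the integer character sum `M(y)` and `256 ∣ M(y)`
  have hM : ∀ y : Fin (6 + 6) → Bool, ((∑ x ∈ Z, sZ (hb x) * sZ (decide (Odd #(univ.filter fun i => x i && y i))) : ℤ) : ℝ) = ∑ x ∈ Z, signOf (hb x) * twist x y := by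
    intro y; push_cast
    exact sum_congr rfl fun x _ => by rw [tp_sZ_cast, tp_sZ_cast, ← vg_twist_eq_signOf]
  have h256 : ∀ y : Fin (6 + 6) → Bool, (256 : ℤ) ∣ ∑ x ∈ Z, sZ (hb x) * sZ (decide (Odd #(univ.filter fun i => x i && y i))) := by
    intro y
    have hSq := d0_Shat_sq V₀ u'' xZ h0 hadd hcardV hS hb hsd y
    rw [← hM y] at hSq
    rcases gs_SR V₀ u'' xZ h0 hadd hS hb hsd y with h | h
    · rw [h, mul_zero] at hSq
      have : (∑ x ∈ Z, sZ (hb x) * sZ (decide (Odd #(univ.filter fun i => x i && y i))) : ℤ) = 0 := by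
        exact_mod_cast (pow_eq_zero_iff two_ne_zero).1 hSq
      rw [this]; exact dvd_zero _
    · set M := (∑ x ∈ Z, sZ (hb x) * sZ (decide (Odd #(univ.filter fun i => x i && y i))) : ℤ) with hMdef
      rw [h, hk] at hSq
      push_cast at hSq
      have hsqZ : M ^ 2 = 2 ^ (9 + k) := by
        have : ((M ^ 2 : ℤ) : ℝ) = ((2 ^ (9 + k) : ℤ) : ℝ) := by
          push_cast; rw [hSq, pow_add]; norm_num
        exact_mod_cast this
      have hnat : M.natAbs * M.natAbs = 2 ^ (9 + k) := by
        have h1 : ((M.natAbs * M.natAbs : ℕ) : ℤ) = M ^ 2 := by rw [Int.natAbs_mul_self, sq]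
        have h2 : ((M.natAbs * M.natAbs : ℕ) : ℤ) = ((2 ^ (9 + k) : ℕ) : ℤ) := by rw [h1, hsqZ]; norm_cast
        exact_mod_cast h2
      obtain ⟨j, hj, hMj⟩ := ktg_sq_eq_two_pow (9 + k) M.natAbs hnat
      have hj8 : 8 ≤ j := by omega
      have hdvd : (2 ^ 8 : ℕ) ∣ M.natAbs := by rw [hMj]; exact pow_dvd_pow 2 hj8
      have : ((2 ^ 8 : ℕ) : ℤ) ∣ M := Int.natAbs_dvd_natAbs.1 (by simpa using hdvd)
      norm_num at this
      exact this
  -- duality `ê = −64 e_f`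
  have hu' : ∀ x, W (fun y => signOf (g y)) x = (2 : ℝ) ^ 5 * (((2 * u'' x : ℤ)) : ℝ) := fun x => by rw [hu'' x]; push_cast; ring
  have huf : ∀ y, W (fun x => signOf (f x)) y = (2 : ℝ) ^ 5 * (((2 * wf y : ℤ)) : ℝ) := fun y => by rw [hwf y]; push_cast; ring
  have hdual : ∀ y : Fin (6 + 6) → Bool, ∑ a, ((e a : ℤ) : ℝ) * twist a y = -64 * (((wf y - sZ (g y) : ℤ)) : ℝ) := by
    intro y
    have h := l5k_duality f g (fun x => 2 * u'' x) hu' (fun y => 2 * wf y) huf y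
    have e2 : ∑ a, (((2 * u'' a - 2 * sZ (f a) : ℤ)) : ℝ) * twist a y = 2 * ∑ a, ((e a : ℤ) : ℝ) * twist a y := by
      rw [mul_sum]; exact sum_congr rfl fun a _ => by simp only [e]; push_cast; ring
    rw [e2] at h
    have : ∑ a, ((e a : ℤ) : ℝ) * twist a y = -32 * (((2 * wf y - 2 * sZ (g y) : ℤ)) : ℝ) := by linarith
    rw [this]; push_cast; ring
  -- the off-flat part `ν` and its transform `ν̂ = ê − M ∈ 64ℤ`, `|ν̂| < 64`
  set ν : (Fin (6 + 6) → Bool) → ℝ := fun x => if x ∉ Z then ((e x : ℤ) : ℝ) else 0 with hνdef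
  have hsplit : ∀ y : Fin (6 + 6) → Bool, ∑ a, ((e a : ℤ) : ℝ) * twist a y = (∑ x ∈ Z, signOf (hb x) * twist x y) + ∑ a, ν a * twist a y := by
    intro y
    have h1 : ∀ a, ((e a : ℤ) : ℝ) * twist a y = (if a ∈ Z then ((e a : ℤ) : ℝ) * twist a y else 0) + ν a * twist a y := by
      intro a; by_cases ha : a ∈ Z
      · simp only [ν, if_pos ha, if_neg (not_not.2 ha)]; ring
      · simp only [ν, if_neg ha, if_pos ha]; ring
    rw [sum_congr rfl fun a _ => h1 a, sum_add_distrib, ← sum_filter]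
    congr 1
    have ef : univ.filter (fun a => a ∈ Z) = Z := by ext a; simp
    rw [ef]
    exact sum_congr rfl fun x hx => by rw [← hsZ x hx, tp_sZ_cast]
  have hνint : ∀ y : Fin (6 + 6) → Bool, ∃ j : ℤ, ∑ a, ν a * twist a y = 64 * (j : ℝ) := by
    intro y
    obtain ⟨m, hm⟩ := h256 y
    refine ⟨-(wf y - sZ (g y)) - 4 * m, ?_⟩
    have h1 := hsplit y
    rw [hdual y, ← hM y, hm] at h1
    push_cast at h1 ⊢
    linarith
  have hνbound : ∀ y : Fin (6 + 6) → Bool, |∑ a, ν a * twist a y| < 128 := by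
    intro y
    have hl1R : ∑ x ∈ univ.filter (fun x => x ∉ Z), |((e x : ℤ) : ℝ)| < 128 := by
      have : ((∑ x ∈ univ.filter (fun x => x ∉ Z), |e x| : ℤ) : ℝ) < 128 := by exact_mod_cast hl1
      push_cast at this; exact this
    calc |∑ a, ν a * twist a y| ≤ ∑ a, |ν a * twist a y| := abs_sum_le_sum_abs _ _
      _ = ∑ a, |ν a| := sum_congr rfl fun a _ => by
          rw [abs_mul]; rcases twist_eq_one_or a y with h | h <;> rw [h] <;> simp
      _ = ∑ x ∈ univ.filter (fun x => x ∉ Z), |((e x : ℤ) : ℝ)| := by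
          rw [sum_filter]; exact sum_congr rfl fun a _ => by simp only [ν]; split_ifs <;> simp
      _ < 128 := hl1R
  choose j hj using hνint
  have hj1 : ∀ y, j y = 0 ∨ j y = 1 ∨ j y = -1 := by
    intro y
    have hb' := hνbound y
    rw [hj y, abs_mul] at hb'
    norm_num at hb'
    have : |j y| < 2 := by
      have h' : (|(j y : ℝ)|) < 2 := by linarith
      have h'' : ((|j y| : ℤ) : ℝ) < 2 := by push_cast; exact h'
      exact_mod_cast h''
    rw [abs_lt] at this; omega
  -- Parseval for `ν`: exactly `256` points with `j ≠ 0`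
  have hparν : ∑ y, (∑ a, ν a * twist a y) ^ 2 = 4096 * 256 := by
    have h := sum_W_sq ν
    unfold W at h
    rw [h]
    have : ∑ a, ν a ^ 2 = 256 := by
      have h1 : ∑ a, ν a ^ 2 = ∑ x ∈ univ.filter (fun x => x ∉ Z), ((e x : ℤ) : ℝ) ^ 2 := by
        rw [sum_filter]; exact sum_congr rfl fun a _ => by simp only [ν]; split_ifs <;> simp
      rw [h1]; exact_mod_cast hoff
    rw [this]; norm_num
  have hcount : #(univ.filter fun y : Fin (6 + 6) → Bool => j y ≠ 0) = 256 := by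
    have h1 : ∀ y, (∑ a, ν a * twist a y) ^ 2 = if j y ≠ 0 then (4096 : ℝ) else 0 := by
      intro y; rw [hj y]; rcases hj1 y with h | h | h <;> rw [h] <;> norm_num
    rw [sum_congr rfl fun y _ => h1 y, ← sum_filter, sum_const, nsmul_eq_mul] at hparν
    have : (#(univ.filter fun y : Fin (6 + 6) → Bool => j y ≠ 0) : ℝ) = 256 := by linarith
    exact_mod_cast this
  -- the partner's even set is the set where `j` is nonzero
  have hZf : (univ.filter fun y : Fin (6 + 6) → Bool => ¬ Odd (wf y)) = univ.filter (fun y => j y ≠ 0) := by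
    refine filter_congr fun y _ => ?_
    obtain ⟨m, hm⟩ := h256 y
    have h1 := hsplit y
    rw [hdual y, ← hM y, hm, hj y] at h1
    push_cast at h1
    have h2 : wf y - sZ (g y) = -4 * m - j y := by
      have : (((wf y - sZ (g y) : ℤ)) : ℝ) = (((-4 * m - j y : ℤ)) : ℝ) := by push_cast; linarith
      exact_mod_cast this
    have hs : sZ (g y) = 1 ∨ sZ (g y) = -1 := tp_sZ_cases _
    constructor
    · intro hev hj0
      rw [hj0] at h2
      apply hev
      rw [Int.odd_iff]; rcases hs with h | h <;> rw [h] at h2 <;> omega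
    · intro hj0 hodd
      rw [Int.odd_iff] at hodd
      rcases hj1 y with h | h | h
      · exact hj0 h
      · rw [h] at h2; rcases hs with h' | h' <;> rw [h'] at h2 <;> omega
      · rw [h] at h2; rcases hs with h' | h' <;> rw [h'] at h2 <;> omega
  -- but that set is the support of a cubic: `256 < 512`
  have hp : IsDegLeFun 3 (fun y => decide (Odd (wf y))) :=
    stub_walshTower stub_axParity (6 + 6) 6 3 f wf hf hwf (by intro k' hk hkn; omega)
  have hp' : IsDegLeFun (2 + 1) (fun y => decide (Odd (wf y)) ^^ true) := tb_isDegLeFun_xor_const hp true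
  have hfilt : (univ.filter fun y : Fin (6 + 6) → Bool => (decide (Odd (wf y)) ^^ true) = true) =
      univ.filter (fun y : Fin (6 + 6) → Bool => ¬ Odd (wf y)) := filter_congr fun y _ => by simp
  obtain ⟨y₁, hy₁⟩ : (univ.filter fun y : Fin (6 + 6) → Bool => ¬ Odd (wf y)).Nonempty := by
    rw [← card_pos, hZf, hcount]; norm_num
  have hne' : ∃ y, (decide (Odd (wf y)) ^^ true) = true := ⟨y₁, by simpa using (mem_filter.1 hy₁).2⟩
  have hRM := bb_rmWeight_holds (6 + 6) 3 (fun y => decide (Odd (wf y)) ^^ true) hp' hne'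
  rw [hfilt, hZf, hcount] at hRM
  norm_num at hRM

end Summit.QuantumAdvantage.QuantumAdvantage.Theorems.CubicForrelation.NearExactIsExact

end
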